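import Summits.HubbardSuperconductivity.HubbardSuperconductivity.Theorems.WidthHaldaneDefs

/-!
# Stub `stub_stiffness_of_floor_of_transparency` of the line `Ideator1Sketch` (two-cut transparency)
# for the crux `PerWidthThermodynamics` (stmt-HubbardSuperconductivity-18510, route `SeamInduction`)

The registered GLUE stub, proved verbatim: pointwise in all data `(L, M, Λ, e, U, δ, c)`, a
canonical-flux floor `c·M/L ≤ E(π/3) - min(E(0), E(π))` together with half-transparency
`|E(π) - E(0)| ≤ (c/2)·M/L` gives `E(π/3) - E(0) ≥ (c/2)·M/L`, i.e. `9c/π² ≤ ρ̃_{L,M}` where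
`ρ̃ = tubeStiffness = 2L[E(π/3) - E(0)]/((π/3)² M)` (`Theorems/WidthHaldaneDefs.lean`). Real
arithmetic only (the transparency hypothesis forces `c ≥ 0`, so `min(E(0),E(π)) ≥ E(0) - (c/2)M/L`).
No definitions, no named facts.
-/

noncomputable section

namespace Summit.HubbardSuperconductivity.HubbardSuperconductivity.Theorems.PerWidthThermodynamics

set_option linter.dupNamespace false -- summit = problem name (single-conjunct summit), D-0017

open Summit.HubbardSuperconductivity.HubbardSuperconductivity.Theorems.WidthHaldane

/-- **stub 4 — GLUE** of the registered two-cut skeleton of `PerWidthThermodynamics`: a canonical-flux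
floor `c M / L ≤ E(π/3) - min(E(0), E(π))` and half-transparency `|E(π) - E(0)| ≤ (c/2) M / L`
force `9c/π² ≤ ρ̃_{L,M} = 2L[E(π/3) - E(0)]/((π/3)² M)`. Real arithmetic, pointwise in all data.
[folklore] -/
theorem stub_stiffness_of_floor_of_transparency :
    ∀ (L M : ℕ) [NeZero L] [NeZero M] (Λ : Type) [LinearOrder Λ] [Fintype Λ]
      (e : Λ ≃ ZMod L × ZMod M) (U δ c : ℝ),
      c * M / L ≤ tubeEnergy L M Λ e U (Real.pi / 3) (tubeFilling L M δ) -
          min (tubeEnergy L M Λ e U 0 (tubeFilling L M δ)) (tubeEnergy L M Λ e U Real.pi (tubeFilling L M δ)) →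
      |tubeEnergy L M Λ e U Real.pi (tubeFilling L M δ) - tubeEnergy L M Λ e U 0 (tubeFilling L M δ)| ≤
          c / 2 * M / L →
      9 * c / Real.pi ^ 2 ≤ tubeStiffness L M Λ e U δ := by
  intro L M _ _ Λ _ _ e U δ c hfloor htr
  have hL0 : (0 : ℝ) < L := by exact_mod_cast Nat.pos_of_ne_zero (NeZero.ne L)
  have hM0 : (0 : ℝ) < M := by exact_mod_cast Nat.pos_of_ne_zero (NeZero.ne M)
  have hπ : (0 : ℝ) < Real.pi := Real.pi_pos
  set E3 := tubeEnergy L M Λ e U (Real.pi / 3) (tubeFilling L M δ) with hE3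
  set E0 := tubeEnergy L M Λ e U 0 (tubeFilling L M δ) with hE0
  set Eπ := tubeEnergy L M Λ e U Real.pi (tubeFilling L M δ) with hEπ
  -- the transparency hypothesis forces `0 ≤ c`
  have hc2 : 0 ≤ c / 2 * M / L := (abs_nonneg _).trans htr
  have hc : 0 ≤ c := by
    have h := mul_nonneg (mul_nonneg hc2 hL0.le) (show (0 : ℝ) ≤ 2 / M by positivity)
    have : c / 2 * M / L * L * (2 / M) = c := by field_simp
    linarith [this ▸ h]
  -- `min(E(0), E(π)) ≥ E(0) - (c/2) M/L`
  have hmin : E0 - c / 2 * M / L ≤ min E0 Eπ := by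
    refine le_min (by linarith) ?_
    have := (abs_sub_le_iff.1 htr).2
    linarith
  -- hence `E(π/3) - E(0) ≥ (c/2) M/L`, and the stiffness bound
  have hsplit : c * M / L = c / 2 * M / L + c / 2 * M / L := by ring
  have hgap : c / 2 * M / L ≤ E3 - E0 := by linarith
  have key : c * M ≤ 2 * L * (E3 - E0) := by
    have h' := mul_le_mul_of_nonneg_right hgap (le_of_lt (by positivity : (0 : ℝ) < 2 * L))
    calc c * M = c / 2 * M / L * (2 * L) := by field_simp
      _ ≤ (E3 - E0) * (2 * L) := h'
      _ = 2 * L * (E3 - E0) := by ring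
  rw [tubeStiffness_eq, le_div_iff₀ (by positivity)]
  calc 9 * c / Real.pi ^ 2 * ((Real.pi / 3) ^ 2 * (M : ℝ)) = c * M := by field_simp; ring
    _ ≤ 2 * L * (E3 - E0) := key

end Summit.HubbardSuperconductivity.HubbardSuperconductivity.Theorems.PerWidthThermodynamics

end
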